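import Mathlib
import HarnessLib
import Summits.QuantumFields.YangMills.Theorems.ComplexCouplingChannelContinuumLegGivenGapAlternatingArraysDefs
import Summits.QuantumFields.YangMills.Theorems.ComplexCouplingChannelContinuumLegGivenGapProductToUniformDefs
import Summits.QuantumFields.YangMills.Theorems.ComplexCouplingChannelContinuumLegGivenGapPtuGeometryBasics
import Summits.QuantumFields.YangMills.Theorems.LangevinControlUVOSLegsFromFemtoAndGapStubAssemblyLatticeSums

/-!
# `ContinuumLegGivenGap` (stmt-QuantumFields-15828), line `alternating-curvature-arrays`: `stub_ptuGeometry`, helper G3 — the COUNTING bound over the index set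

Support file for the registered piece `stub_ptuGeometry` (geometry of the Whitney system of
`Theorems/ComplexCouplingChannelContinuumLegGivenGapProductToUniformDefs.lean`): for every level `m`, every choice of
one configuration `g(v,z)` in the cell boxes of each index `(v, z) ∈ ptuIdx L m p`,
`∑_{(v,z) ∈ ptuIdx} (1 + ‖g(v,z)‖)^{-6p} ≤ (2p+1)^4 (c · max(1, ℓ⁻⁴))^p`, `ℓ = a · cellSide m`, with ONE absolute
constant `c = 625 + 729 · 81 ∑ₙ (n+1)⁻²`.

Route: a point of the cell `[a(v + S k), a(v + S(k+1))]` (`0 ≤ v ≤ S`) has modulus `≥ aS(|k| - 2)` (§1), so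
`(1 + ‖g(v,z)‖)^{-6} ≤ G(zᵢ) := max(1, 1 + ℓ(‖zᵢ‖ - 2))^{-6}` for every `i` and the summand is `≤ ∏ᵢ G(zᵢ)`; the index set
sits inside `ptuOffsets × ptuCellBox^p` (`≤ (2p+1)^4` offsets), the sum factorises into `(∑_{k ∈ cellBox} G(k))^p`, and
the one-cell lattice sum is `≤ 5^4 + 3^6 · (81 ∑ₙ (n+1)⁻²) · max(1, ℓ⁻⁴)` (§2: cells of sup norm `≤ 2` counted, the others
compared with the tree's `a`-uniform Riemann-sum bound `OSLegsFromFemtoAndGap.sum_decay_le` at `a = min ℓ 1`).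
Registered anchor: `ptuGeom_counting` (§3). [folklore]
-/

set_option autoImplicit false

noncomputable section

open scoped Classical

namespace Summit.QuantumFields.YangMills.Theorems.ContinuumLegGivenGap

open scoped BigOperators
open Summit.QuantumFields.YangMills.Theorems.ContinuumLegGivenGap.AlternatingArrays

/-! ## §1 Points of a cell are far from the origin -/

/-- A point `t` of the cell `[a(v + S k), a(v + S(k+1))]` of a grid with offset `0 ≤ v ≤ S` has `|t| ≥ aS(|k| - 2)`.
[folklore] -/
theorem ptu_abs_ge_of_mem_cell {a S v t : ℝ} {k : ℤ} (ha : 0 ≤ a) (hv0 : 0 ≤ v) (hvS : v ≤ S)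
    (h1 : a * (v + S * k) ≤ t) (h2 : t ≤ a * (v + S * (k + 1))) : a * S * (|(k : ℝ)| - 2) ≤ |t| := by
  have hS : 0 ≤ S := hv0.trans hvS
  have haS : 0 ≤ a * S := mul_nonneg ha hS
  have hav : 0 ≤ a * v := mul_nonneg ha hv0
  have havS : a * v ≤ a * S := mul_le_mul_of_nonneg_left hvS ha
  rcases le_or_gt 0 (k : ℝ) with hk | hk
  · rw [abs_of_nonneg hk]
    calc a * S * ((k : ℝ) - 2) ≤ a * S * k := by nlinarith
      _ ≤ t := by linarith
      _ ≤ |t| := le_abs_self t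
  · rw [abs_of_neg hk]
    calc a * S * (-(k : ℝ) - 2) = -(a * S * (k + 1) + a * S) := by ring
      _ ≤ -(a * S * (k + 1) + a * v) := by linarith
      _ ≤ -t := by linarith
      _ ≤ |t| := neg_le_abs t

/-- **Pointwise bound.** If every point `xᵢ` of a configuration lies in the cell box of `zᵢ` (grid offset
`0 ≤ v ≤ S`, spacing `a`), then `(1 + ‖x‖)^{-6} ≤ max(1, 1 + aS(‖zᵢ‖ - 2))^{-6}` for every `i`. [folklore] -/
theorem ptu_inv_pow_le_of_mem_cell {a S : ℝ} (ha : 0 < a) (hS : 0 < S) {p : ℕ} {v : Fin 4 → ℤ}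
    {z : Fin p → Fin 4 → ℤ} (hv : ∀ μ, (0 : ℝ) ≤ v μ ∧ (v μ : ℝ) ≤ S) {x : Fin p → EuclideanSpace ℝ (Fin 4)}
    (hx : ∀ (i : Fin p) (μ : Fin 4), a * ((v μ : ℝ) + S * (z i μ : ℝ)) ≤ x i μ ∧
      x i μ ≤ a * ((v μ : ℝ) + S * ((z i μ : ℝ) + 1))) (i : Fin p) :
    ((1 + ‖x‖) ^ 6)⁻¹ ≤ ((max 1 (1 + a * S * (‖z i‖ - 2))) ^ 6)⁻¹ := by
  have hℓ : 0 < a * S := mul_pos ha hS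
  have hzi : ‖z i‖ * (a * S) ≤ ‖x‖ + 2 * (a * S) := by
    have h0 : ‖z i‖ ≤ (‖x‖ + 2 * (a * S)) / (a * S) := by
      rw [pi_norm_le_iff_of_nonneg (by positivity)]
      intro μ
      rw [Int.norm_eq_abs, le_div_iff₀ hℓ]
      have h := ptu_abs_ge_of_mem_cell ha.le (hv μ).1 (hv μ).2 (hx i μ).1 (hx i μ).2
      have h2a : ‖x i μ‖ ≤ ‖x i‖ := PiLp.norm_apply_le (x i) μ
      rw [Real.norm_eq_abs] at h2a
      have h2b : ‖x i‖ ≤ ‖x‖ := norm_le_pi_norm x i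
      nlinarith
    rwa [le_div_iff₀ hℓ] at h0
  have hB : max 1 (1 + a * S * (‖z i‖ - 2)) ≤ 1 + ‖x‖ := by
    refine max_le (by linarith [norm_nonneg x]) ?_
    nlinarith
  exact inv_anti₀ (by positivity) (pow_le_pow_left₀ (by positivity) hB 6)

/-! ## §2 The one-cell lattice sum -/

/-- **One-cell lattice sum.** For `ℓ > 0` and every finite set of cells of `ℤ⁴`:
`∑ₖ max(1, 1 + ℓ(‖k‖ - 2))^{-6} ≤ (5^4 + 3^6 · 81 ∑ₙ (n+1)⁻²) · max(1, ℓ⁻⁴)`. [folklore] -/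
theorem ptu_cell_sum_le {ℓ : ℝ} (hℓ : 0 < ℓ) (s : Finset (Fin 4 → ℤ)) :
    ∑ k ∈ s, ((max 1 (1 + ℓ * (‖k‖ - 2))) ^ 6)⁻¹ ≤
      (625 + 729 * (81 * ∑' n : ℕ, (((n : ℝ) + 1) ^ 2)⁻¹)) * max 1 (ℓ⁻¹ ^ 4) := by
  set K : ℝ := 81 * ∑' n : ℕ, (((n : ℝ) + 1) ^ 2)⁻¹ with hK
  have hK0 : 0 ≤ K := by positivity
  set G : (Fin 4 → ℤ) → ℝ := fun k => ((max 1 (1 + ℓ * (‖k‖ - 2))) ^ 6)⁻¹ with hG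
  have hG1 : ∀ k, G k ≤ 1 := fun k => inv_le_one_of_one_le₀ (one_le_pow₀ (le_max_left _ _))
  have hM : 1 ≤ max 1 (ℓ⁻¹ ^ 4) := le_max_left _ _
  rw [← Finset.sum_filter_add_sum_filter_not s (fun k => ‖k‖ ≤ 2)]
  -- cells of sup norm `≤ 2`: at most `5^4`, each term `≤ 1`
  have hA : ∑ k ∈ s.filter (fun k => ‖k‖ ≤ 2), G k ≤ 625 := by
    have hsub : s.filter (fun k => ‖k‖ ≤ 2) ⊆
        Fintype.piFinset fun _ : Fin 4 => Finset.Icc (-((2 : ℕ) : ℤ)) ((2 : ℕ) : ℤ) := by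
      intro k hk
      rw [Finset.mem_filter] at hk
      rw [Fintype.mem_piFinset]
      intro μ
      have h1 : ‖k μ‖ ≤ 2 := (norm_le_pi_norm k μ).trans hk.2
      rw [Int.norm_eq_abs] at h1
      have h2 : ((|k μ| : ℤ) : ℝ) ≤ 2 := by rw [Int.cast_abs]; exact h1
      have h3 : |k μ| ≤ 2 := by exact_mod_cast h2
      rw [Finset.mem_Icc]
      obtain ⟨h4, h5⟩ := abs_le.1 h3
      constructor <;> omega
    calc ∑ k ∈ s.filter (fun k => ‖k‖ ≤ 2), G k ≤ ∑ _k ∈ s.filter (fun k => ‖k‖ ≤ 2), (1 : ℝ) :=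
          Finset.sum_le_sum fun k _ => hG1 k
      _ = (s.filter (fun k => ‖k‖ ≤ 2)).card := by rw [Finset.sum_const, nsmul_eq_mul, mul_one]
      _ ≤ (Fintype.piFinset fun _ : Fin 4 => Finset.Icc (-((2 : ℕ) : ℤ)) ((2 : ℕ) : ℤ)).card := by
          exact_mod_cast Finset.card_le_card hsub
      _ = 625 := by rw [OSLegsFromFemtoAndGap.card_piFinset_Icc]; norm_num
  -- cells of sup norm `≥ 3`: compare with the `a`-uniform Riemann sum at `a = min ℓ 1`
  set ℓ' : ℝ := min ℓ 1 with hℓ'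
  have hℓ'0 : 0 < ℓ' := lt_min hℓ one_pos
  have hℓ'1 : ℓ' ≤ 1 := min_le_right _ _
  have hℓ'ℓ : ℓ' ≤ ℓ := min_le_left _ _
  have hinv : ℓ'⁻¹ ^ 4 ≤ max 1 (ℓ⁻¹ ^ 4) := by
    rcases le_or_gt ℓ 1 with h | h
    · rw [show ℓ' = ℓ from min_eq_left h]
      exact le_max_right _ _
    · rw [show ℓ' = 1 from min_eq_right h.le]
      simp
  have hB : ∑ k ∈ s.filter (fun k => ¬‖k‖ ≤ 2), G k ≤ 729 * K * max 1 (ℓ⁻¹ ^ 4) := by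
    have hterm : ∀ k ∈ s.filter (fun k => ¬‖k‖ ≤ 2),
        G k ≤ 729 * ℓ'⁻¹ ^ 4 * (ℓ' ^ 4 * ((1 + ℓ' * ‖k‖) ^ 6)⁻¹) := by
      intro k hk
      rw [Finset.mem_filter] at hk
      -- `‖k‖ ≥ 3`
      have hk3 : (3 : ℝ) ≤ ‖k‖ := by
        have hk2 := hk.2
        rw [pi_norm_le_iff_of_nonneg (by norm_num : (0 : ℝ) ≤ 2)] at hk2
        push Not at hk2
        obtain ⟨μ, hμ⟩ := hk2
        rw [Int.norm_eq_abs] at hμ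
        have h3 : (3 : ℤ) ≤ |k μ| := by
          have h3a : (2 : ℝ) < ((|k μ| : ℤ) : ℝ) := by rw [Int.cast_abs]; exact hμ
          have h3b : (2 : ℤ) < |k μ| := by exact_mod_cast h3a
          omega
        have h4 : (3 : ℝ) ≤ ‖k μ‖ := by
          rw [Int.norm_eq_abs, ← Int.cast_abs]
          exact_mod_cast h3
        exact h4.trans (norm_le_pi_norm k μ)
      have hk1 : ℓ' * ‖k‖ ≤ ℓ * ‖k‖ := mul_le_mul_of_nonneg_right hℓ'ℓ (norm_nonneg k)
      have hk2 : ℓ * 3 ≤ ℓ * ‖k‖ := mul_le_mul_of_nonneg_left hk3 hℓ.le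
      have hbase : (1 + ℓ' * ‖k‖) / 3 ≤ 1 + ℓ * (‖k‖ - 2) := by
        rw [div_le_iff₀ (by norm_num : (0 : ℝ) < 3)]
        nlinarith
      have hpos : 0 < 1 + ℓ' * ‖k‖ := by positivity
      have hmax : max 1 (1 + ℓ * (‖k‖ - 2)) = 1 + ℓ * (‖k‖ - 2) := max_eq_right (by nlinarith)
      have e : ℓ'⁻¹ ^ 4 * ℓ' ^ 4 = 1 := by rw [inv_pow, inv_mul_cancel₀ (pow_ne_zero 4 hℓ'0.ne')]
      show ((max 1 (1 + ℓ * (‖k‖ - 2))) ^ 6)⁻¹ ≤ _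
      rw [hmax]
      have h6 : ((1 + ℓ' * ‖k‖) / 3) ^ 6 ≤ (1 + ℓ * (‖k‖ - 2)) ^ 6 := pow_le_pow_left₀ (by positivity) hbase 6
      calc ((1 + ℓ * (‖k‖ - 2)) ^ 6)⁻¹ ≤ (((1 + ℓ' * ‖k‖) / 3) ^ 6)⁻¹ := inv_anti₀ (by positivity) h6
        _ = 729 * ((1 + ℓ' * ‖k‖) ^ 6)⁻¹ := by rw [div_pow, inv_div, div_eq_mul_inv]; norm_num
        _ = 729 * (ℓ'⁻¹ ^ 4 * ℓ' ^ 4) * ((1 + ℓ' * ‖k‖) ^ 6)⁻¹ := by rw [e, mul_one]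
        _ = 729 * ℓ'⁻¹ ^ 4 * (ℓ' ^ 4 * ((1 + ℓ' * ‖k‖) ^ 6)⁻¹) := by ring
    calc ∑ k ∈ s.filter (fun k => ¬‖k‖ ≤ 2), G k
        ≤ ∑ k ∈ s.filter (fun k => ¬‖k‖ ≤ 2), 729 * ℓ'⁻¹ ^ 4 * (ℓ' ^ 4 * ((1 + ℓ' * ‖k‖) ^ 6)⁻¹) :=
          Finset.sum_le_sum hterm
      _ = 729 * ℓ'⁻¹ ^ 4 * ∑ k ∈ s.filter (fun k => ¬‖k‖ ≤ 2), ℓ' ^ 4 * ((1 + ℓ' * ‖k‖) ^ 6)⁻¹ := by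
          rw [Finset.mul_sum]
      _ ≤ 729 * ℓ'⁻¹ ^ 4 * K :=
          mul_le_mul_of_nonneg_left (OSLegsFromFemtoAndGap.sum_decay_le hℓ'0 hℓ'1 (le_refl 6) _) (by positivity)
      _ ≤ 729 * K * max 1 (ℓ⁻¹ ^ 4) := by nlinarith [mul_le_mul_of_nonneg_left hinv hK0]
  calc ∑ k ∈ s.filter (fun k => ‖k‖ ≤ 2), G k + ∑ k ∈ s.filter (fun k => ¬‖k‖ ≤ 2), G k
      ≤ 625 + 729 * K * max 1 (ℓ⁻¹ ^ 4) := add_le_add hA hB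
    _ ≤ (625 + 729 * K) * max 1 (ℓ⁻¹ ^ 4) := by nlinarith

/-! ## §3 The counting bound -/

/-- **Counting bound** (registered anchor of this file): with `c = 625 + 729 · 81 ∑ₙ (n+1)⁻²`, for every level `m`
and every choice `g` of one configuration in the cell boxes of each index of `ptuIdx L m p`,
`∑_{vz ∈ ptuIdx} ((1 + ‖g vz‖)^6)⁻¹)^p ≤ (2p+1)^4 (c · max(1, (a · cellSide m)⁻¹ ^ 4))^p`. [folklore] -/
theorem ptuGeom_counting : ∃ c : ℝ, 0 < c ∧ ∀ (a : ℝ) (L p : ℕ), 0 < a →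
    ∀ m ∈ ptuLevels L p, ∀ g : (Fin 4 → ℤ) × (Fin p → Fin 4 → ℤ) → (Fin p → EuclideanSpace ℝ (Fin 4)),
      (∀ vz ∈ ptuIdx L m p, ∀ (i : Fin p) (μ : Fin 4),
        a * ((vz.1 μ : ℝ) + cellSide m * (vz.2 i μ : ℝ)) ≤ g vz i μ ∧
          g vz i μ ≤ a * ((vz.1 μ : ℝ) + cellSide m * ((vz.2 i μ : ℝ) + 1))) →
      ∑ vz ∈ ptuIdx L m p, (((1 + ‖g vz‖) ^ 6)⁻¹) ^ p ≤
        (2 * (p : ℝ) + 1) ^ 4 * (c * max 1 ((a * cellSide m)⁻¹ ^ 4)) ^ p := by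
  set K : ℝ := 81 * ∑' n : ℕ, (((n : ℝ) + 1) ^ 2)⁻¹ with hK
  have hK0 : 0 ≤ K := by positivity
  refine ⟨625 + 729 * K, by positivity, ?_⟩
  intro a L p ha m _ g hg
  have hS : 0 < cellSide m := by unfold cellSide; positivity
  have hℓ0 : 0 < a * cellSide m := mul_pos ha hS
  set G : (Fin 4 → ℤ) → ℝ := fun k => ((max 1 (1 + a * cellSide m * (‖k‖ - 2))) ^ 6)⁻¹ with hG
  have hG0 : ∀ k, 0 ≤ G k := fun k => by positivity
  -- pointwise bound on the index set
  have hpt : ∀ vz ∈ ptuIdx L m p, (((1 + ‖g vz‖) ^ 6)⁻¹) ^ p ≤ ∏ i, G (vz.2 i) := by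
    intro vz hvz
    have hv : ∀ μ, (0 : ℝ) ≤ vz.1 μ ∧ (vz.1 μ : ℝ) ≤ cellSide m := fun μ => by
      obtain ⟨h0, h1⟩ := ptuOffsets_spec (mem_ptuIdx hvz).1 μ
      exact ⟨h0, by linarith [(Nat.cast_nonneg (ptuD m p) : (0 : ℝ) ≤ _)]⟩
    have hi : ∀ i : Fin p, ((1 + ‖g vz‖) ^ 6)⁻¹ ≤ G (vz.2 i) := fun i =>
      ptu_inv_pow_le_of_mem_cell ha hS hv (hg vz hvz) i
    have h0 : 0 ≤ ((1 + ‖g vz‖) ^ 6)⁻¹ := by positivity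
    have key : ∀ (F : Fin p → ℝ) (b : ℝ), 0 ≤ b → (∀ i, b ≤ F i) → b ^ p ≤ ∏ i, F i := by
      intro F b hb hF
      calc b ^ p = ∏ _i : Fin p, b := by rw [Finset.prod_const, Finset.card_univ, Fintype.card_fin]
        _ ≤ ∏ i, F i := Finset.prod_le_prod (fun i _ => hb) fun i _ => hF i
    exact key (fun i => G (vz.2 i)) _ h0 hi
  -- the index set sits inside `offsets × cellBox^p`
  have hsub : ptuIdx L m p ⊆ (ptuOffsets m p) ×ˢ Fintype.piFinset (fun _ : Fin p => ptuCellBox L) := by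
    unfold ptuIdx
    exact Finset.filter_subset _ _
  have hcard : ((ptuOffsets m p).card : ℝ) ≤ (2 * (p : ℝ) + 1) ^ 4 := by
    have h1 : (ptuOffsets m p).card ≤ (2 * p + 1) ^ 4 := by
      unfold ptuOffsets
      refine Finset.card_image_le.trans ?_
      rw [Finset.card_univ, Fintype.card_fun, Fintype.card_fin, Fintype.card_fin]
    exact_mod_cast h1
  have hcell : ∑ k ∈ ptuCellBox L, G k ≤ (625 + 729 * K) * max 1 ((a * cellSide m)⁻¹ ^ 4) :=
    ptu_cell_sum_le hℓ0 _
  have hcell0 : 0 ≤ ∑ k ∈ ptuCellBox L, G k := Finset.sum_nonneg fun k _ => hG0 k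
  have hfac : ∑ z ∈ Fintype.piFinset (fun _ : Fin p => ptuCellBox L), ∏ i, G (z i) =
      (∑ k ∈ ptuCellBox L, G k) ^ p := by
    rw [← Finset.prod_univ_sum (fun _ : Fin p => ptuCellBox L) (fun _ k => G k)]
    rw [Finset.prod_const, Finset.card_univ, Fintype.card_fin]
  calc ∑ vz ∈ ptuIdx L m p, (((1 + ‖g vz‖) ^ 6)⁻¹) ^ p
      ≤ ∑ vz ∈ ptuIdx L m p, ∏ i, G (vz.2 i) := Finset.sum_le_sum hpt
    _ ≤ ∑ vz ∈ (ptuOffsets m p) ×ˢ Fintype.piFinset (fun _ : Fin p => ptuCellBox L), ∏ i, G (vz.2 i) :=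
        Finset.sum_le_sum_of_subset_of_nonneg hsub fun vz _ _ => Finset.prod_nonneg fun i _ => hG0 _
    _ = ∑ _v ∈ ptuOffsets m p, ∑ z ∈ Fintype.piFinset (fun _ : Fin p => ptuCellBox L), ∏ i, G (z i) :=
        Finset.sum_product _ _ _
    _ = (ptuOffsets m p).card * (∑ k ∈ ptuCellBox L, G k) ^ p := by
        rw [Finset.sum_const, nsmul_eq_mul, hfac]
    _ ≤ (2 * (p : ℝ) + 1) ^ 4 * ((625 + 729 * K) * max 1 ((a * cellSide m)⁻¹ ^ 4)) ^ p :=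
        mul_le_mul hcard (pow_le_pow_left₀ hcell0 hcell p) (pow_nonneg hcell0 p) (by positivity)

end Summit.QuantumFields.YangMills.Theorems.ContinuumLegGivenGap

end
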